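import Literature.GroupTheory.CombinatorialGroupTheory.ReidemeisterSchreierCovering
import Literature.GroupTheory.CombinatorialGroupTheory.SchreierIndexFormula
import HarnessLib

/-!
# The free basis of a subgroup of a free group attached to a Schreier tree

Topic `Literature/GroupTheory/CombinatorialGroupTheory`; theorems only.  Continues
`ReidemeisterSchreierCovering.lean` (abc-iut-L5-d3) in the relator-free case: `F(X)` acts on a set
`A` (through `act`), `K ≤ F(X)` is the stabiliser of the base point `a₀`, and `𝒯` is a Schreier
tree (`CoveringPresentation.SchreierTree`: transversal `t`, tree edges).  Then (Schreier 1927;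
Zieschang–Vogt–Coldewey LNM 835, 2.2.2–2.2.4 with no relators; Lyndon–Schupp I Prop. 3.7–3.9):

* `exists_mulEquiv_nonTreeEdges` — `K` is FREELY generated by the Schreier generators
  `γ(x, a) = t(x·a)⁻¹ · x · t(a)` of the NON-tree edges: an isomorphism
  `Φ : F({e ∉ tree}) ≃* K` with `Φ(e) = γ(e)`, whose inverse is "rewrite `k` as the edge word of
  its path at `a₀` and delete the tree edges";
* `card_nonTreeEdges_add_index` — for `X` finite and `K` of finite index,
  `#{non-tree edges} + [F : K] = [F : K] · #X + 1` (all free bases of `K` are equipotent; the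
  count is the Schreier index formula `SchreierIndexFormula.lean`).

Consumer: the "Schreier ribbon graph" layer (BRICK 2, abc-iut-w5-d186) of the cell's theorem on
finite-index subgroups of punctured surface groups, which reads the boundary words of the lifted
faces in exactly this basis.
-/

namespace Literature.GroupTheory.CombinatorialGroupTheory

namespace CoveringPresentation

open Classical in
/-- **Schreier's free basis from a Schreier tree.**  Let `F(X)` act on `A`, let `K` be the
stabiliser of `a₀` and `𝒯` a Schreier tree at `a₀`.  Then there is an isomorphism
`Φ : F({e ∉ 𝒯.edges}) ≃* K` sending the non-tree edge `e = (x, a)` to the Schreier generator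
`t(x·a)⁻¹ · x · t(a)`, whose inverse sends `k ∈ K` to the edge word of the path of `k` ending at `a₀`
with the tree edges deleted. [cite: ZieschangVogtColdewey1980, 2.2.2–2.2.4]
[cite: LyndonSchupp2001, Ch. I Prop. 3.7] -/
theorem exists_mulEquiv_nonTreeEdges {X : Type*} {A : Type*} {act : FreeGroup X →* Equiv.Perm A}
    {a₀ : A} (𝒯 : SchreierTree act a₀) (K : Subgroup (FreeGroup X))
    (hK : ∀ f, f ∈ K ↔ act f a₀ = a₀) :
    ∃ Φ : FreeGroup {e : X × A // e ∉ 𝒯.edges} ≃* K,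
      (∀ e, ((Φ (FreeGroup.of e) : K) : FreeGroup X) =
        (𝒯.t (act (FreeGroup.of e.1.1) e.1.2))⁻¹ * FreeGroup.of e.1.1 * 𝒯.t e.1.2) ∧
      (∀ k : K, Φ.symm k =
        FreeGroup.lift (fun e : X × A =>
          if h : e ∈ 𝒯.edges then (1 : FreeGroup {e : X × A // e ∉ 𝒯.edges})
          else FreeGroup.of ⟨e, h⟩) (pathWord act (k : FreeGroup X) a₀)) := by
  -- the two homomorphisms
  set ι : FreeGroup {e : X × A // e ∉ 𝒯.edges} →* FreeGroup (X × A) :=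
    FreeGroup.map fun e => e.1 with hι
  set φ : FreeGroup {e : X × A // e ∉ 𝒯.edges} →* K := (gammaStab 𝒯 K hK).comp ι with hφ
  set kill : FreeGroup (X × A) →* FreeGroup {e : X × A // e ∉ 𝒯.edges} :=
    FreeGroup.lift fun e : X × A =>
      if h : e ∈ 𝒯.edges then (1 : FreeGroup {e : X × A // e ∉ 𝒯.edges}) else FreeGroup.of ⟨e, h⟩
    with hkill
  have hstab : ∀ k : K, act (k : FreeGroup X)⁻¹ a₀ = a₀ := fun k => by
    rw [map_inv, Equiv.Perm.inv_eq_iff_eq]; exact ((hK k).1 k.2).symm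
  set ψ : K →* FreeGroup {e : X × A // e ∉ 𝒯.edges} :=
    MonoidHom.mk' (fun k => kill (pathWord act (k : FreeGroup X) a₀)) fun k k' => by
      simp only [Subgroup.coe_mul, pathWord_mul, hstab, map_mul]
    with hψ
  -- `kill` kills the tree paths
  have hkill_of_mem : ∀ e ∈ 𝒯.edges, kill (FreeGroup.of e) = 1 := fun e he => by
    rw [hkill, FreeGroup.lift_apply_of, dif_pos he]
  have hkill_tree : ∀ a, kill (pathWord act (𝒯.t a) a) = 1 := fun a => by
    have h := 𝒯.pathWord_t_mem a
    rw [← MonoidHom.mem_ker]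
    refine (Subgroup.closure_le kill.ker).2 ?_ h
    rintro _ ⟨e, he, rfl⟩
    exact hkill_of_mem e he
  -- `K.subtype ∘ φ ∘ kill = γ`
  have hγ : K.subtype.comp (φ.comp kill) = gammaHom 𝒯 := by
    refine FreeGroup.ext_hom _ _ fun e => ?_
    rw [MonoidHom.comp_apply, MonoidHom.comp_apply, gammaHom_of]
    by_cases he : e ∈ 𝒯.edges
    · rw [hkill_of_mem e he, map_one, map_one, 𝒯.t_edge e he, mul_inv_rev, inv_mul_cancel_right,
        inv_mul_cancel]
    · rw [hkill, FreeGroup.lift_apply_of, dif_neg he, hφ, MonoidHom.comp_apply, hι,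
        FreeGroup.map.of, Subgroup.coe_subtype, coe_gammaStab, gammaHom_of]
  have perm_inv_apply : ∀ (σ : Equiv.Perm A) (b : A), σ⁻¹ (σ b) = b := fun σ b =>
    Equiv.Perm.inv_eq_iff_eq.mpr rfl
  refine ⟨(MonoidHom.toMulEquiv φ ψ ?_ ?_), fun e => ?_, fun k => ?_⟩
  · -- `ψ ∘ φ = id` on the non-tree edges
    refine FreeGroup.ext_hom _ _ fun e => ?_
    rw [MonoidHom.comp_apply, MonoidHom.id_apply, hψ, MonoidHom.mk'_apply, hφ,
      MonoidHom.comp_apply, hι, FreeGroup.map.of, coe_gammaStab, gammaHom_of,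
      pathWord_mul_mul, pathWord_inv, map_inv act, map_inv act, inv_inv, 𝒯.t_apply, map_mul,
      map_mul, map_inv, hkill_tree, inv_one, one_mul, pathWord_of, map_inv act,
      perm_inv_apply, hkill_tree, mul_one, hkill, FreeGroup.lift_apply_of, dif_neg e.2]
  · -- `φ ∘ ψ = id` on `K`
    refine MonoidHom.ext fun k => Subtype.ext ?_
    rw [MonoidHom.comp_apply, MonoidHom.id_apply, hψ, MonoidHom.mk'_apply]
    have h := DFunLike.congr_fun hγ (pathWord act (k : FreeGroup X) a₀)
    rw [MonoidHom.comp_apply, MonoidHom.comp_apply, Subgroup.coe_subtype] at h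
    rw [h, gammaHom_pathWord, 𝒯.t_root, inv_one, one_mul, hstab, 𝒯.t_root, mul_one]
  · rw [MonoidHom.toMulEquiv_apply, hφ, MonoidHom.comp_apply, hι, FreeGroup.map.of, coe_gammaStab,
      gammaHom_of]
  · rw [MonoidHom.toMulEquiv_symm_apply, hψ, MonoidHom.mk'_apply]

universe u

/-- **The number of non-tree edges**: for `X` finite, `K` of finite index the stabiliser of `a₀`,
and any Schreier tree `𝒯`, `#{e ∉ 𝒯.edges} + [F(X) : K] = [F(X) : K] · #X + 1` — the non-tree
edges form a free basis of `K`, all free bases of `K` are equipotent, and the rank of `K` is given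
by the Schreier index formula. [cite: LyndonSchupp2001, Ch. I Prop. 3.9]
[cite: ZieschangVogtColdewey1980, 2.2.4] -/
theorem card_nonTreeEdges_add_index {X A : Type u} [Finite X] {act : FreeGroup X →* Equiv.Perm A}
    {a₀ : A} (𝒯 : SchreierTree act a₀) (K : Subgroup (FreeGroup X)) [K.FiniteIndex]
    (hK : ∀ f, f ∈ K ↔ act f a₀ = a₀) :
    Nat.card {e : X × A // e ∉ 𝒯.edges} + K.index = K.index * Nat.card X + 1 := by
  obtain ⟨Φ, -, -⟩ := exists_mulEquiv_nonTreeEdges 𝒯 K hK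
  obtain ⟨ι, b, _, hcard⟩ := FreeGroup.exists_freeGroupBasis_of_finiteIndex K
  have e : {e : X × A // e ∉ 𝒯.edges} ≃ ι := Equiv.ofFreeGroupEquiv (Φ.trans b.repr)
  rw [Nat.card_congr e]
  exact hcard

open Classical in
/-- **Rewriting through the basis**: if `Φ : F({e ∉ 𝒯.edges}) ≃* K` takes the Schreier-generator
values on the non-tree edges (as in `exists_mulEquiv_nonTreeEdges`), then for every edge word `w`,
`Φ` of "`w` with the tree edges deleted" is `γ(w)` (`CoveringPresentation.gammaHom`): the tree edges
have trivial Schreier generators. [cite: ZieschangVogtColdewey1980, 2.2.3] -/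
theorem coe_apply_lift_eq_gammaHom {X : Type*} {A : Type*} {act : FreeGroup X →* Equiv.Perm A}
    {a₀ : A} (𝒯 : SchreierTree act a₀) (K : Subgroup (FreeGroup X))
    (Φ : FreeGroup {e : X × A // e ∉ 𝒯.edges} ≃* K)
    (hΦ : ∀ e, ((Φ (FreeGroup.of e) : K) : FreeGroup X) =
      (𝒯.t (act (FreeGroup.of e.1.1) e.1.2))⁻¹ * FreeGroup.of e.1.1 * 𝒯.t e.1.2)
    (w : FreeGroup (X × A)) :
    ((Φ (FreeGroup.lift (fun e : X × A =>
        if h : e ∈ 𝒯.edges then (1 : FreeGroup {e : X × A // e ∉ 𝒯.edges})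
        else FreeGroup.of ⟨e, h⟩) w) : K) : FreeGroup X) = gammaHom 𝒯 w := by
  set kill : FreeGroup (X × A) →* FreeGroup {e : X × A // e ∉ 𝒯.edges} :=
    FreeGroup.lift fun e : X × A =>
      if h : e ∈ 𝒯.edges then (1 : FreeGroup {e : X × A // e ∉ 𝒯.edges}) else FreeGroup.of ⟨e, h⟩
    with hkill
  have h : K.subtype.comp (Φ.toMonoidHom.comp kill) = gammaHom 𝒯 := by
    refine FreeGroup.ext_hom _ _ fun e => ?_
    rw [MonoidHom.comp_apply, MonoidHom.comp_apply, gammaHom_of, hkill, FreeGroup.lift_apply_of]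
    by_cases he : e ∈ 𝒯.edges
    · rw [dif_pos he, map_one, map_one, 𝒯.t_edge e he, mul_inv_rev, inv_mul_cancel_right,
        inv_mul_cancel]
    · rw [dif_neg he, MulEquiv.coe_toMonoidHom, Subgroup.coe_subtype, hΦ]
  have hw := DFunLike.congr_fun h w
  rwa [MonoidHom.comp_apply, MonoidHom.comp_apply, MulEquiv.coe_toMonoidHom,
    Subgroup.coe_subtype] at hw

open Classical in
/-- **The lifted closed path of `f` at a vertex `b` fixed by `f`**: deleting the tree edges from the
edge word `pathWord act f b` of the (closed) path of `f` ending at `b` gives the element of the free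
basis group which `Φ` sends to `t(b)⁻¹ · f · t(b) ∈ K` — the boundary word of a lifted face, read in
the Schreier basis, is the conjugate of the face relation by the representative of its sheet.
[cite: ZieschangVogtColdewey1980, 2.2.3] [cite: ZieschangVogtColdewey1980, Thm 4.14.1 p.150] -/
theorem coe_apply_lift_pathWord_of_apply_eq {X : Type*} {A : Type*}
    {act : FreeGroup X →* Equiv.Perm A} {a₀ : A} (𝒯 : SchreierTree act a₀)
    (K : Subgroup (FreeGroup X)) (Φ : FreeGroup {e : X × A // e ∉ 𝒯.edges} ≃* K)
    (hΦ : ∀ e, ((Φ (FreeGroup.of e) : K) : FreeGroup X) =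
      (𝒯.t (act (FreeGroup.of e.1.1) e.1.2))⁻¹ * FreeGroup.of e.1.1 * 𝒯.t e.1.2)
    {f : FreeGroup X} {b : A} (hfb : act f b = b) :
    ((Φ (FreeGroup.lift (fun e : X × A =>
        if h : e ∈ 𝒯.edges then (1 : FreeGroup {e : X × A // e ∉ 𝒯.edges})
        else FreeGroup.of ⟨e, h⟩) (pathWord act f b)) : K) : FreeGroup X) =
      (𝒯.t b)⁻¹ * f * 𝒯.t b := by
  have hb : act f⁻¹ b = b := by rw [map_inv, Equiv.Perm.inv_eq_iff_eq, hfb]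
  rw [coe_apply_lift_eq_gammaHom 𝒯 K Φ hΦ, gammaHom_pathWord, hb]

/-- `Fintype` form of `card_nonTreeEdges_add_index` (the shape in which the ribbon-graph layer
consumes it): `Fintype.card {e ∉ 𝒯.edges} + [F(X) : K] = [F(X) : K] · Fintype.card X + 1`.
[cite: LyndonSchupp2001, Ch. I Prop. 3.9] -/
theorem fintypeCard_nonTreeEdges_add_index {X A : Type u} [Fintype X]
    {act : FreeGroup X →* Equiv.Perm A} {a₀ : A} (𝒯 : SchreierTree act a₀)
    [Fintype {e : X × A // e ∉ 𝒯.edges}] (K : Subgroup (FreeGroup X)) [K.FiniteIndex]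
    (hK : ∀ f, f ∈ K ↔ act f a₀ = a₀) :
    Fintype.card {e : X × A // e ∉ 𝒯.edges} + K.index = K.index * Fintype.card X + 1 := by
  rw [← Nat.card_eq_fintype_card, ← Nat.card_eq_fintype_card]
  exact card_nonTreeEdges_add_index 𝒯 K hK

end CoveringPresentation

end Literature.GroupTheory.CombinatorialGroupTheory
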